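import Summits.MatrixMultiplication.MatrixMultiplication.Theorems.AbelianSTPPCensusShapeCertVPDefs

/-!
# Abelian STPP census — kernel evaluation of the vP certificate checker `ShapeCertVP` (H: orders 310–317)

Cell mm-stpp, route `AbelianSTPPCensusVP`, crux `ShapeExclusionVP337` (stmt-MatrixMultiplication-19191); support file
(no definitions).  `ShapeCertVP.checkV M = true` by `decide +kernel` (no `native_decide`, standard axioms), ONE theorem
per order so that every kernel evaluation starts with empty caches (measured in the seat folder: ≈ 4–8 s per order below
300, ≤ 35 s at the orders 300–337 — candidate-list construction plus the `feasP` packings of the visited nodes);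
`Elab.async false` keeps the evaluations of this file sequential (one kernel computation in memory at a time; tree
precedent `NeelSignC23EK0Cert4`).  The range lemma `checkV_310_317` at the end collects the file; the ten ranges are
assembled on `128 ≤ M ≤ 337` in `AbelianSTPPCensusVPShapeExclusionVP337.lean`, where `ShapeCertVP.checkV_sound`
(`…ShapeCertVPSearch`) and the bridge `ShapeCertVP.shapeExclusionVP_of_checkV` (`…ShapeCertVPFinal`) turn them into
the crux.
-/

set_option linter.dupNamespace false -- `MatrixMultiplication.MatrixMultiplication` (summit = problem, D-0017)
set_option autoImplicit false
set_option Elab.async false -- sequential kernel evaluations (memory high-water of one order at a time)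

namespace Summit.MatrixMultiplication.MatrixMultiplication.Theorems.ShapeCertVP

set_option maxHeartbeats 0 in
/-- certificate check at order `310` (kernel evaluation) -/
theorem checkV_310 : checkV 310 = true := by
  decide +kernel

set_option maxHeartbeats 0 in
/-- certificate check at order `311` (kernel evaluation) -/
theorem checkV_311 : checkV 311 = true := by
  decide +kernel

set_option maxHeartbeats 0 in
/-- certificate check at order `312` (kernel evaluation) -/
theorem checkV_312 : checkV 312 = true := by
  decide +kernel

set_option maxHeartbeats 0 in
/-- certificate check at order `313` (kernel evaluation) -/
theorem checkV_313 : checkV 313 = true := by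
  decide +kernel

set_option maxHeartbeats 0 in
/-- certificate check at order `314` (kernel evaluation) -/
theorem checkV_314 : checkV 314 = true := by
  decide +kernel

set_option maxHeartbeats 0 in
/-- certificate check at order `315` (kernel evaluation) -/
theorem checkV_315 : checkV 315 = true := by
  decide +kernel

set_option maxHeartbeats 0 in
/-- certificate check at order `316` (kernel evaluation) -/
theorem checkV_316 : checkV 316 = true := by
  decide +kernel

set_option maxHeartbeats 0 in
/-- certificate check at order `317` (kernel evaluation) -/
theorem checkV_317 : checkV 317 = true := by
  decide +kernel

/-- **The vP certificate holds at every order `310 ≤ M ≤ 317`** (collects the evaluations of this file). -/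
theorem checkV_310_317 (M : ℕ) (h₁ : 310 ≤ M) (h₂ : M ≤ 317) : checkV M = true := by
  interval_cases M
  · exact checkV_310
  · exact checkV_311
  · exact checkV_312
  · exact checkV_313
  · exact checkV_314
  · exact checkV_315
  · exact checkV_316
  · exact checkV_317

end Summit.MatrixMultiplication.MatrixMultiplication.Theorems.ShapeCertVP
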